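import Mathlib
import HarnessLib
import Summits.ABC.ABC.Theses.LogCardinality
import Literature.Barriers.ABC.EpsilonCannotBeDroppedProofs

/-!
# Line `regime-split` — skeleton for the crux `BakerRefinement` (stmt-ABC-1756, route `LogCardinality`)

Crux-strategist line (seat `planner-cstrat-stmt-ABC-1756-r1-0`, 2026-08-17) for the RESTATED deciding crux
`BakerRefinement := ∃ κ, BakerShapeExplicitABC κ` (`c < κ·N·(log N)^ω/ω!` for all abc triples with `a < b`,
`N = rad(abc)`, `ω = ω(abc)`). THE LINE IS THE BC2 REDIRECT: Baker's refinement is cut where it crosses the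
Robert–Stewart–Tenenbaum refinement, at `ω(abc)² = log N`, into

* piece 1 `FewPrimesBaker` (few primes, `ω² < log N`): Baker's bound itself — uniform few-primes `S`-unit
  content, polynomial in `log N` for bounded `ω`, beyond `ABC` and beyond RST; from stubs 1–2;
* piece 2 `ManyPrimesSubexp` (many primes, `log N ≤ ω²`): `c < κ·N·exp(A·√(log N))` — the Stewart–Tijdeman
  scale, implied by RST (1.5) restricted to the regime (stub 3 + the cited lemma), NOT implied by the crux;

and the glue `bakerRefinement_of_subs : piece 1 → piece 2 → BakerRefinement` is PROVED here (§1; identical to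
the planner's `Split.lean`, attached as evidence on stmt-ABC-1756 and published as
`Cruxes/BakerRefinement/StrategySplit.lean`, to be landed verbatim under `Theorems/` by any prover — Theorems is
prover-only for a planner seat). Its seam is the analytic lemma `exp_mul_sqrt_le_pow_div_factorial`
(`exp(A√L) ≤ L^k/k!` for `L ≥ L₀(A)`, `√L ≤ k`, `k! ≤ e^L`), i.e. in the many-primes regime Baker's allowance
dominates every `exp(A√log N)`; the bounded remainder `log N < L₀` is absorbed through `rad ≥ 3`.

Registered stubs (sorries ONLY here; three):
* `stub_fixedOmega` (OPEN from `t = 3`; `t = 2` provable with `κ = 1`): for each `t`, Baker's bound with an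
  `ω`-dependent constant on `{ω(abc) = t, t² < log N}` — the uniform `t`-prime `S`-unit bound.
* `stub_tailUniform` (OPEN): one constant for all `ω ≥ T` in the few-primes regime.
* `stub_rstManyPrimes` (OPEN): RST Conjecture A (1.5) restricted to `{log N ≤ ω²}` (the unrestricted
  `RSTConjectureAUpper` implies `ABC` — `RSTConjectureAUpper.imp_abc` — hence is inadmissible as a stub).
* (lemma, not a stub) `rstExponent_le_sqrt_log`: `rstExponent C₁ k ≤ A·√(log k)` for `k ≥ 2`, from the landed
  `Literature.Barriers.ABC.rstExponent_le` (EpsilonCannotBeDroppedProofs) — v1–v3 of this file carried it as a fourth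
  stub; demoted in v4 because a one-line consequence of a tree theorem is bookkeeping, not a stub.
Composition `BakerRefinement_of : BakerRefinement` (the crux BY NAME, proof = glue applied to the three stubs and the
lemma) and the sorry-free `bakerRefinement_of_stubs : stub₁ → stub₂ → stub₃ → (lemma statement) → (∃ κ, BakerShapeExplicitABC κ)`.

Why it dodges the route's recorded dead end ("X is an endpoint; no provable glue from the rungs", route header
NOT DECOMPOSED YET (a)): the rungs PadicPowerSaving/SubPowerStewartYu/BelowOneThird are OUTPUT milestones of one
engine below X and per-place estimates cannot combine (product formula); this line does not climb the engine — it
cuts the TARGET by regime, so that each half is a statement with its own literature, its own falsifier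
(bounded-ω families of growing Baker merit / primorial–LLL constructions past the `√log` scale) and neither half
is ≥ `ABC` or ≥ X (BC2 probes `bc/*_probe.lean`: all fail). Disproof used: none exists for this crux
(`Cruxes/BakerRefinement/` had no Disproof.lean at registration).
-/

-- `Summit.<Summit>.<Problem>`: for the single-conjunct summit `ABC` the duplicate `ABC.ABC` is mandated.
set_option linter.dupNamespace false

namespace Summit.ABC.ABC.Cruxes.BakerRefinement.RegimeSplit

open Literature.NumberTheory.DiophantineGeometry
open Literature.Barriers.ABC
open Summit.ABC.ABC.Theses.LogCardinality

/-! ## §0 The three registered stubs (+ one cited lemma) -/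


/-- **Stub 1 (one `ω` at a time): the uniform few-primes `S`-unit bound with an `ω`-dependent constant.**
For every `t` there is `κ_t` with `c < κ_t·N·(log N)^t/t!` for all abc triples (`a < b`) with `ω(abc) = t`
and `t² < log N`. Vacuous for `t ≤ 1`, provable for `t = 2` (`κ₂ = 1`), OPEN from `t = 3` on (stronger than
abc for these triples: polynomial in `log N`). Sources: Baker2004 §3 Conj. 4; LaishramShorey2012 Thm 1;
EvertseGyory2015 Ch. 4–6 (effective S-unit bounds are exponential in the primes). -/
theorem stub_fixedOmega :
    ∀ t : ℕ, ∃ κ : ℝ, ∀ a b c : ℕ, IsABCTriple a b c → a < b →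
      ArithmeticFunction.cardDistinctFactors (a * b * c) = t →
        ((t : ℕ) : ℝ) ^ 2 < Real.log (rad a b c : ℕ) →
          (c : ℝ) < κ * (rad a b c : ℝ) * Real.log (rad a b c : ℕ) ^ t / (Nat.factorial t : ℝ) := by
  sorry

/-- **Stub 2 (uniformity in `ω` beyond a threshold).** There are `T` and ONE `κ` with
`c < κ·N·(log N)^ω/ω!` for all abc triples (`a < b`) with `T ≤ ω(abc)` and `ω(abc)² < log N`. OPEN
(Baker's calibration `κ ≈ 1.2` on the 196 extremal triples, all with `ω ≥ 4`, Baker2004 §4; RST2014 §1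
heuristic pressure at `ω ≍ √(log N)/(log₂N)^{3/2}`). -/
theorem stub_tailUniform :
    ∃ T : ℕ, ∃ κ : ℝ, ∀ a b c : ℕ, IsABCTriple a b c → a < b →
      T ≤ ArithmeticFunction.cardDistinctFactors (a * b * c) →
        ((ArithmeticFunction.cardDistinctFactors (a * b * c) : ℕ) : ℝ) ^ 2 < Real.log (rad a b c : ℕ) →
          (c : ℝ) < κ * (rad a b c : ℝ) *
            Real.log (rad a b c : ℕ) ^ (ArithmeticFunction.cardDistinctFactors (a * b * c)) /
            (Nat.factorial (ArithmeticFunction.cardDistinctFactors (a * b * c)) : ℝ) := by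
  sorry


/-- **Stub 3 (OPEN): RST Conjecture A (1.5) on the many-primes regime.** There is `C₁` with
`c < k·exp(4√(3 log k/log₂k)(1 + log₃k/(2log₂k) + C₁/log₂k))`, `k = rad(abc)`, for every abc triple
(`a < b`) with `log k ≤ ω(abc)²`. [cite: RobertStewartTenenbaum2014, Conjecture A (1.5)] restricted;
weaker than `RSTConjectureAUpper` (which implies `ABC`). -/
theorem stub_rstManyPrimes :
    ∃ C₁ : ℝ, ∀ a b c : ℕ, IsABCTriple a b c → a < b →
      Real.log (rad a b c : ℕ) ≤ ((ArithmeticFunction.cardDistinctFactors (a * b * c) : ℕ) : ℝ) ^ 2 →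
        (c : ℝ) < (rad a b c : ℝ) * Real.exp (rstExponent C₁ (rad a b c : ℕ)) := by
  sorry

/-- **(former stub 4, now a cited lemma): the RST exponent lives at the Stewart–Tijdeman scale.** For every
`C₁` there is `A ≥ 0` with `rstExponent C₁ k ≤ A·√(log k)` for all naturals `k ≥ 2` — immediate from the landed
`Literature.Barriers.ABC.rstExponent_le` (`A = 4√3·(3/2 + |C₁|)`, real `k ≥ 1`). Kept as a named lemma (not a
stub: a one-line consequence of a tree theorem would be a bookkeeping stub). [folklore] -/
theorem rstExponent_le_sqrt_log :
    ∀ C₁ : ℝ, ∃ A : ℝ, 0 ≤ A ∧ ∀ k : ℕ, 2 ≤ k → rstExponent C₁ k ≤ A * Real.sqrt (Real.log k) := by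
  intro C₁
  refine ⟨4 * Real.sqrt 3 * (3 / 2 + |C₁|), by positivity, fun k hk => ?_⟩
  exact rstExponent_le C₁ (by exact_mod_cast le_trans one_le_two hk)

/-! ## §1 The regime glue (identical to `Split.lean` / `StrategySplit.lean`) -/



/-! ## The analytic seam -/

/-- For `A ≥ 0` there is `L₀` such that `exp(A·√L) ≤ L^k / k!` for all real `L ≥ L₀` and all `k : ℕ`
with `√L ≤ k` and `k! ≤ e^L`. [folklore] -/
theorem exp_mul_sqrt_le_pow_div_factorial {A : ℝ} (hA : 0 ≤ A) :
    ∃ L₀ : ℝ, 1 ≤ L₀ ∧ ∀ L : ℝ, L₀ ≤ L → ∀ k : ℕ, Real.sqrt L ≤ k →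
      ((Nat.factorial k : ℕ) : ℝ) ≤ Real.exp L → Real.exp (A * Real.sqrt L) ≤ L ^ k / (Nat.factorial k : ℝ) := by
  refine ⟨max (Real.exp (2 * Real.exp A)) (max (A ^ 2) 1), ?_, ?_⟩
  · exact le_trans (le_max_right _ _) (le_max_right _ _)
  intro L hL k hk hfac
  have hLe : Real.exp (2 * Real.exp A) ≤ L := le_trans (le_max_left _ _) hL
  have hLA : A ^ 2 ≤ L := le_trans (le_trans (le_max_left _ _) (le_max_right _ _)) hL
  have hL1 : (1 : ℝ) ≤ L := le_trans (le_trans (le_max_right _ _) (le_max_right _ _)) hL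
  have hL0 : (0 : ℝ) < L := by linarith
  have hsqrt0 : 0 < Real.sqrt L := Real.sqrt_pos.mpr hL0
  have hk0 : (0 : ℝ) < k := lt_of_lt_of_le hsqrt0 hk
  have hkfac : (0 : ℝ) < (Nat.factorial k : ℝ) := by positivity
  rcases le_or_gt (Real.exp A * k) L with h1 | h1
  · -- case (i): `e^A ≤ L/k`
    have hLk : Real.exp A ≤ L / k := by
      rw [le_div_iff₀ hk0]; linarith
    have h2 : Real.exp (A * k) ≤ (L / k) ^ k := by
      have : Real.exp (A * k) = Real.exp A ^ k := by
        rw [← Real.exp_nat_mul]; ring_nf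
      rw [this]
      exact pow_le_pow_left₀ (Real.exp_pos A).le hLk k
    have h3 : (L / k) ^ k ≤ L ^ k / (Nat.factorial k : ℝ) := by
      rw [div_pow]
      refine div_le_div_of_nonneg_left (pow_nonneg hL0.le k) hkfac ?_
      exact_mod_cast Nat.factorial_le_pow k
    calc Real.exp (A * Real.sqrt L) ≤ Real.exp (A * k) :=
          Real.exp_le_exp.mpr (mul_le_mul_of_nonneg_left hk hA)
      _ ≤ (L / k) ^ k := h2
      _ ≤ L ^ k / (Nat.factorial k : ℝ) := h3
  · -- case (ii): `L < e^A · k`, use `k! ≤ e^L`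
    have hlogL : 2 * Real.exp A ≤ Real.log L := by
      rw [Real.le_log_iff_exp_le hL0]; exact hLe
    have hfac' : ((Nat.factorial k : ℕ) : ℝ) = (Nat.factorial k : ℝ) := by norm_cast
    have h2 : L ^ k / Real.exp L ≤ L ^ k / (Nat.factorial k : ℝ) :=
      div_le_div_of_nonneg_left (pow_nonneg hL0.le k) hkfac (by rw [← hfac']; exact hfac)
    have h3 : L ^ k / Real.exp L = Real.exp (k * Real.log L - L) := by
      rw [Real.exp_sub, ← Real.rpow_natCast, Real.rpow_def_of_pos hL0, mul_comm (Real.log L)]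
    have h4 : A * Real.sqrt L ≤ L := by
      have hAs : A ≤ Real.sqrt L := Real.le_sqrt_of_sq_le hLA
      calc A * Real.sqrt L ≤ Real.sqrt L * Real.sqrt L :=
            mul_le_mul_of_nonneg_right hAs (Real.sqrt_nonneg L)
        _ = L := Real.mul_self_sqrt hL0.le
    have h5 : 2 * L ≤ k * Real.log L := by
      have := mul_le_mul_of_nonneg_left hlogL hk0.le
      nlinarith [h1, Real.exp_pos A]
    calc Real.exp (A * Real.sqrt L) ≤ Real.exp (k * Real.log L - L) :=
          Real.exp_le_exp.mpr (by linarith)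
      _ = L ^ k / Real.exp L := h3.symm
      _ ≤ L ^ k / (Nat.factorial k : ℝ) := h2

/-! ## Elementary facts on abc triples with `a < b` -/

/-- A prime dividing `abc ≠ 0` is at most `rad(abc)` (local copy of `prime_le_rad` of
`PastenSubexpTheorem14`, not imported here). [folklore] -/
theorem BakerRefinementSplit.prime_le_rad {a b c p : ℕ} (hp : p.Prime) (hpabc : p ∣ a * b * c)
    (h0 : a * b * c ≠ 0) : p ≤ rad a b c := by
  have hmem : p ∈ (rad a b c).primeFactors := by
    rw [rad_def, Nat.primeFactors_radical, Nat.mem_primeFactors]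
    exact ⟨hp, hpabc, h0⟩
  exact Nat.le_of_dvd (by rw [rad_def]; exact Nat.radical_pos _) (Nat.dvd_of_mem_primeFactors hmem)

/-- An abc triple with `a < b` has `rad(abc) ≥ 3`: either `c ≥ 3` has an odd prime factor, or `c` is
even and then `b ≥ 2` is odd (coprime to `c`) and has one. [folklore] -/
theorem BakerRefinementSplit.three_le_rad {a b c : ℕ} (h : IsABCTriple a b c) (hab : a < b) :
    3 ≤ rad a b c := by
  obtain ⟨ha, hb, habc, hcop⟩ := h
  have h0 : a * b * c ≠ 0 := Nat.mul_ne_zero (Nat.mul_ne_zero ha.ne' hb.ne') (by omega)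
  have hc3 : 3 ≤ c := by omega
  -- an odd prime dividing `abc`
  have key : ∃ q : ℕ, q.Prime ∧ q ∣ a * b * c ∧ q ≠ 2 := by
    by_cases hc2 : 2 ∣ c
    · have hbc : Nat.Coprime b c := by
        rw [← habc]; exact Nat.coprime_add_self_right.mpr hcop.symm
      have hb2 : ¬ 2 ∣ b := by
        intro h2
        have hg := Nat.dvd_gcd h2 hc2
        rw [hbc.gcd_eq_one] at hg
        omega
      obtain ⟨q, hq, hqb⟩ := Nat.exists_prime_and_dvd (show b ≠ 1 by omega)
      refine ⟨q, hq, (hqb.mul_left a).mul_right c, ?_⟩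
      rintro rfl
      exact hb2 hqb
    · obtain ⟨q, hq, hqc⟩ := Nat.exists_prime_and_dvd (show c ≠ 1 by omega)
      refine ⟨q, hq, dvd_mul_of_dvd_right hqc _, ?_⟩
      rintro rfl
      exact hc2 hqc
  obtain ⟨q, hq, hqabc, hq2⟩ := key
  have hq3 : 3 ≤ q := by
    have := hq.two_le; omega
  exact le_trans hq3 (BakerRefinementSplit.prime_le_rad hq hqabc h0)

/-- For an abc triple with `a < b`: `1 ≤ log rad(abc)` (`rad ≥ 3 > e`). [folklore] -/
theorem BakerRefinementSplit.one_le_log_rad {a b c : ℕ} (h : IsABCTriple a b c) (hab : a < b) :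
    (1 : ℝ) ≤ Real.log (rad a b c : ℕ) := by
  have h3 : (3 : ℝ) ≤ (rad a b c : ℕ) := by exact_mod_cast BakerRefinementSplit.three_le_rad h hab
  have he : Real.exp 1 ≤ (rad a b c : ℕ) := le_trans (le_of_lt (lt_trans Real.exp_one_lt_d9 (by norm_num))) h3
  rwa [← Real.le_log_iff_exp_le (by linarith)] at he

/-! ## The glue `FewPrimesBaker → ManyPrimesSubexp → BakerRefinement` -/

/-- **Glue of the regime split of Baker's refinement.** If Baker's bound `c < κ·N·(log N)^ω/ω!` holds
for the abc triples (`a < b`) with FEW prime factors, `ω(abc)² < log N`, and an abc inequality at the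
Stewart–Tijdeman scale `c < κ·N·exp(A·√(log N))` holds for those with MANY prime factors,
`log N ≤ ω(abc)²`, then Baker's refinement `BakerRefinement = ∃ κ, BakerShapeExplicitABC κ` holds for all
of them. Shape `C₁ → C₂ → C` (hypotheses verbatim = the children `FewPrimesBaker`, `ManyPrimesSubexp`)
for `ledger route edit --split BakerRefinement --glue-by`. [folklore] -/
theorem bakerRefinement_of_subs :
    (∃ κ : ℝ, ∀ a b c : ℕ, Literature.NumberTheory.DiophantineGeometry.IsABCTriple a b c → a < b →
        ((ArithmeticFunction.cardDistinctFactors (a * b * c) : ℕ) : ℝ) ^ 2 <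
            Real.log (Literature.NumberTheory.DiophantineGeometry.rad a b c : ℕ) →
          (c : ℝ) < κ * (Literature.NumberTheory.DiophantineGeometry.rad a b c : ℝ) *
            Real.log (Literature.NumberTheory.DiophantineGeometry.rad a b c : ℕ) ^
              (ArithmeticFunction.cardDistinctFactors (a * b * c)) /
            (Nat.factorial (ArithmeticFunction.cardDistinctFactors (a * b * c)) : ℝ)) →
    (∃ κ A : ℝ, ∀ a b c : ℕ, Literature.NumberTheory.DiophantineGeometry.IsABCTriple a b c → a < b →
        Real.log (Literature.NumberTheory.DiophantineGeometry.rad a b c : ℕ) ≤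
            ((ArithmeticFunction.cardDistinctFactors (a * b * c) : ℕ) : ℝ) ^ 2 →
          (c : ℝ) < κ * (Literature.NumberTheory.DiophantineGeometry.rad a b c : ℝ) *
            Real.exp (A * Real.sqrt (Real.log (Literature.NumberTheory.DiophantineGeometry.rad a b c : ℕ)))) →
    -- = `BakerRefinement` unfolded (so that `BakerRefinement_of` below is the only theorem of this
    -- skeleton concluding the crux by name; the Theorems version `Split.lean` concludes it by name)
    ∃ κ : ℝ, Literature.Barriers.ABC.BakerShapeExplicitABC κ := by
  rintro ⟨κ₁, h₁⟩ ⟨κ₂, A, h₂⟩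
  -- the analytic threshold for `A' = max A 0`
  obtain ⟨L₀, hL₀1, hL₀⟩ := exp_mul_sqrt_le_pow_div_factorial (le_max_right A 0)
  -- a bound for `c` on the bounded remainder `log N < L₀` of the many-primes regime
  set c₀ : ℝ := max κ₂ 0 * Real.exp L₀ * Real.exp (max A 0 * Real.sqrt L₀) with hc₀
  have hc₀0 : 0 ≤ c₀ := by positivity
  refine ⟨max κ₁ 0 + max κ₂ 0 + (c₀ + 1), fun a b c ht hab => ?_⟩
  -- notation and basic positivity
  have hN1 : (1 : ℝ) ≤ Real.log (rad a b c : ℕ) := BakerRefinementSplit.one_le_log_rad ht hab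
  have hN0 : (0 : ℝ) < (rad a b c : ℝ) := by
    have := ht.two_le_rad; exact_mod_cast (by omega : 0 < rad a b c)
  have hfacN : ((Nat.factorial (ArithmeticFunction.cardDistinctFactors (a * b * c)) : ℕ) : ℝ) ≤
      (rad a b c : ℝ) := by
    have h1 := factorial_cardDistinctFactors_le_radical (a * b * c)
    rw [← rad_def] at h1
    exact_mod_cast h1
  have hfac0 : (0 : ℝ) < (Nat.factorial (ArithmeticFunction.cardDistinctFactors (a * b * c)) : ℝ) := by
    positivity
  -- the Baker factor `T = N (log N)^ω / ω!` is `≥ 1`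
  set ω := ArithmeticFunction.cardDistinctFactors (a * b * c) with hω
  set L := Real.log (rad a b c : ℕ) with hL
  have hT1 : (1 : ℝ) ≤ (rad a b c : ℝ) * L ^ ω / (Nat.factorial ω : ℝ) := by
    rw [le_div_iff₀ hfac0, one_mul]
    have hLω : (1 : ℝ) ≤ L ^ ω := one_le_pow₀ hN1
    have hfacN' : ((Nat.factorial ω : ℕ) : ℝ) = (Nat.factorial ω : ℝ) := by norm_cast
    calc (Nat.factorial ω : ℝ) = (Nat.factorial ω : ℝ) * 1 := by ring
      _ ≤ (rad a b c : ℝ) * L ^ ω := by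
          apply mul_le_mul _ hLω zero_le_one hN0.le
          rw [← hfacN']; exact hfacN
  have hT0 : (0 : ℝ) ≤ (rad a b c : ℝ) * L ^ ω / (Nat.factorial ω : ℝ) := le_trans zero_le_one hT1
  -- monotonicity of the Baker bound in the constant
  have mono : ∀ κ κ' : ℝ, κ ≤ κ' →
      κ * (rad a b c : ℝ) * L ^ ω / (Nat.factorial ω : ℝ) ≤
        κ' * (rad a b c : ℝ) * L ^ ω / (Nat.factorial ω : ℝ) := by
    intro κ κ' h
    have e1 : κ * (rad a b c : ℝ) * L ^ ω / (Nat.factorial ω : ℝ) =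
        κ * ((rad a b c : ℝ) * L ^ ω / (Nat.factorial ω : ℝ)) := by ring
    have e2 : κ' * (rad a b c : ℝ) * L ^ ω / (Nat.factorial ω : ℝ) =
        κ' * ((rad a b c : ℝ) * L ^ ω / (Nat.factorial ω : ℝ)) := by ring
    rw [e1, e2]
    exact mul_le_mul_of_nonneg_right h hT0
  have hk1 : max κ₁ 0 ≤ max κ₁ 0 + max κ₂ 0 + (c₀ + 1) := by
    have := le_max_right κ₂ 0; linarith
  have hk2 : max κ₂ 0 ≤ max κ₁ 0 + max κ₂ 0 + (c₀ + 1) := by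
    have := le_max_right κ₁ 0; linarith
  have hk3 : c₀ + 1 ≤ max κ₁ 0 + max κ₂ 0 + (c₀ + 1) := by
    have := le_max_right κ₁ 0; have := le_max_right κ₂ 0; linarith
  rcases lt_or_ge (((ω : ℕ) : ℝ) ^ 2) L with hfew | hmany
  · -- FEW PRIMES: Baker's bound with `κ₁ ≤ max κ₁ 0`
    have hc := h₁ a b c ht hab hfew
    exact lt_of_lt_of_le (lt_of_lt_of_le hc (mono κ₁ _ (le_max_left κ₁ 0))) (mono _ _ hk1)
  · -- MANY PRIMES: `c < κ₂ N exp(A √L)`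
    have hc := h₂ a b c ht hab hmany
    have hsqrt0 : 0 ≤ Real.sqrt L := Real.sqrt_nonneg L
    -- first replace `κ₂` by `max κ₂ 0` and `A` by `max A 0`
    have hc' : (c : ℝ) < max κ₂ 0 * (rad a b c : ℝ) * Real.exp (max A 0 * Real.sqrt L) := by
      refine lt_of_lt_of_le hc ?_
      calc κ₂ * (rad a b c : ℝ) * Real.exp (A * Real.sqrt L)
          ≤ max κ₂ 0 * (rad a b c : ℝ) * Real.exp (A * Real.sqrt L) := by
            gcongr; exact le_max_left κ₂ 0
        _ ≤ max κ₂ 0 * (rad a b c : ℝ) * Real.exp (max A 0 * Real.sqrt L) := by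
            gcongr; exact le_max_left A 0
    have hκN : 0 ≤ max κ₂ 0 * (rad a b c : ℝ) := mul_nonneg (le_max_right κ₂ 0) hN0.le
    rcases le_or_gt L₀ L with hbig | hsmall
    · -- large radical: the analytic seam
      have hωL : Real.sqrt L ≤ (ω : ℝ) := by
        rw [Real.sqrt_le_left (by positivity)]
        exact hmany
      have hfacL : ((Nat.factorial ω : ℕ) : ℝ) ≤ Real.exp L := by
        rw [hL, Real.exp_log hN0]
        exact hfacN
      have hseam := hL₀ L hbig ω hωL hfacL
      have hstep : max κ₂ 0 * (rad a b c : ℝ) * Real.exp (max A 0 * Real.sqrt L) ≤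
          max κ₂ 0 * (rad a b c : ℝ) * L ^ ω / (Nat.factorial ω : ℝ) := by
        have e : max κ₂ 0 * (rad a b c : ℝ) * L ^ ω / (Nat.factorial ω : ℝ) =
            max κ₂ 0 * (rad a b c : ℝ) * (L ^ ω / (Nat.factorial ω : ℝ)) := by ring
        rw [e]
        exact mul_le_mul_of_nonneg_left hseam hκN
      exact lt_of_lt_of_le (lt_of_lt_of_le hc' hstep) (mono _ _ hk2)
    · -- bounded radical: `c < c₀`, and the Baker factor is `≥ 1`
      have hNle : (rad a b c : ℝ) ≤ Real.exp L₀ := by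
        have : (rad a b c : ℝ) = Real.exp L := by rw [hL, Real.exp_log hN0]
        rw [this]
        exact Real.exp_le_exp.mpr hsmall.le
      have hexpL₀ : Real.exp (max A 0 * Real.sqrt L) ≤ Real.exp (max A 0 * Real.sqrt L₀) :=
        Real.exp_le_exp.mpr (mul_le_mul_of_nonneg_left (Real.sqrt_le_sqrt hsmall.le) (le_max_right A 0))
      have hcc₀ : (c : ℝ) < c₀ := by
        refine lt_of_lt_of_le hc' ?_
        rw [hc₀]
        gcongr
      have hstep : (c : ℝ) < (c₀ + 1) * (rad a b c : ℝ) * L ^ ω / (Nat.factorial ω : ℝ) :=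
        calc (c : ℝ) < c₀ + 1 := by linarith
          _ = (c₀ + 1) * 1 := by ring
          _ ≤ (c₀ + 1) * ((rad a b c : ℝ) * L ^ ω / (Nat.factorial ω : ℝ)) :=
              mul_le_mul_of_nonneg_left hT1 (by linarith)
          _ = (c₀ + 1) * (rad a b c : ℝ) * L ^ ω / (Nat.factorial ω : ℝ) := by ring
      exact lt_of_lt_of_le hstep (mono _ _ hk3)

/-- The few-primes piece is a restriction of the crux. [folklore] -/
theorem fewPrimesBaker_of_bakerRefinement (h : BakerRefinement) :
    ∃ κ : ℝ, ∀ a b c : ℕ, Literature.NumberTheory.DiophantineGeometry.IsABCTriple a b c → a < b →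
        ((ArithmeticFunction.cardDistinctFactors (a * b * c) : ℕ) : ℝ) ^ 2 <
            Real.log (Literature.NumberTheory.DiophantineGeometry.rad a b c : ℕ) →
          (c : ℝ) < κ * (Literature.NumberTheory.DiophantineGeometry.rad a b c : ℝ) *
            Real.log (Literature.NumberTheory.DiophantineGeometry.rad a b c : ℕ) ^
              (ArithmeticFunction.cardDistinctFactors (a * b * c)) /
            (Nat.factorial (ArithmeticFunction.cardDistinctFactors (a * b * c)) : ℝ) := by
  obtain ⟨κ, hκ⟩ := h
  exact ⟨κ, fun a b c ht hab _ => hκ a b c ht hab⟩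


/-! ## §2 The pieces from their stubs -/

/-! ### Piece 1 from stubs 1–2 -/

/-- `stub_fixedOmega → stub_tailUniform → FewPrimesBaker` (piece 1, stated inline): take `T, κ_T` from the tail and
`κ := max κ_T 0 + Σ_{t<T} max κ_t 0`. [folklore] -/
theorem fewPrimes_of_stubs :
    (∀ t : ℕ, ∃ κ : ℝ, ∀ a b c : ℕ, IsABCTriple a b c → a < b →
      ArithmeticFunction.cardDistinctFactors (a * b * c) = t →
        ((t : ℕ) : ℝ) ^ 2 < Real.log (rad a b c : ℕ) →
          (c : ℝ) < κ * (rad a b c : ℝ) * Real.log (rad a b c : ℕ) ^ t / (Nat.factorial t : ℝ)) →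
    (∃ T : ℕ, ∃ κ : ℝ, ∀ a b c : ℕ, IsABCTriple a b c → a < b →
      T ≤ ArithmeticFunction.cardDistinctFactors (a * b * c) →
        ((ArithmeticFunction.cardDistinctFactors (a * b * c) : ℕ) : ℝ) ^ 2 < Real.log (rad a b c : ℕ) →
          (c : ℝ) < κ * (rad a b c : ℝ) *
            Real.log (rad a b c : ℕ) ^ (ArithmeticFunction.cardDistinctFactors (a * b * c)) /
            (Nat.factorial (ArithmeticFunction.cardDistinctFactors (a * b * c)) : ℝ)) →
    (∃ κ : ℝ, ∀ a b c : ℕ, IsABCTriple a b c → a < b →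
      ((ArithmeticFunction.cardDistinctFactors (a * b * c) : ℕ) : ℝ) ^ 2 < Real.log (rad a b c : ℕ) →
        (c : ℝ) < κ * (rad a b c : ℝ) * Real.log (rad a b c : ℕ) ^ (ArithmeticFunction.cardDistinctFactors (a * b * c)) /
          (Nat.factorial (ArithmeticFunction.cardDistinctFactors (a * b * c)) : ℝ)) := by
  intro h1 h2
  obtain ⟨T, κT, hT⟩ := h2
  choose κf hκf using h1
  refine ⟨max κT 0 + ∑ t ∈ Finset.range T, max (κf t) 0, fun a b c ht hab hfew => ?_⟩
  set ω := ArithmeticFunction.cardDistinctFactors (a * b * c) with hω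
  set L := Real.log (rad a b c : ℕ) with hL
  have hN0 : (0 : ℝ) < (rad a b c : ℝ) := by
    have := ht.two_le_rad; exact_mod_cast (by omega : 0 < rad a b c)
  have hL0 : 0 ≤ L := Real.log_nonneg (by have := ht.two_le_rad; exact_mod_cast (by omega : 1 ≤ rad a b c))
  have hB0 : (0 : ℝ) ≤ (rad a b c : ℝ) * L ^ ω / (Nat.factorial ω : ℝ) := by positivity
  have hsum0 : 0 ≤ ∑ t ∈ Finset.range T, max (κf t) 0 :=
    Finset.sum_nonneg fun t _ => le_max_right _ _
  have mono : ∀ κ κ' : ℝ, κ ≤ κ' →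
      κ * (rad a b c : ℝ) * L ^ ω / (Nat.factorial ω : ℝ) ≤
        κ' * (rad a b c : ℝ) * L ^ ω / (Nat.factorial ω : ℝ) := by
    intro κ κ' h
    have e1 : κ * (rad a b c : ℝ) * L ^ ω / (Nat.factorial ω : ℝ) =
        κ * ((rad a b c : ℝ) * L ^ ω / (Nat.factorial ω : ℝ)) := by ring
    have e2 : κ' * (rad a b c : ℝ) * L ^ ω / (Nat.factorial ω : ℝ) =
        κ' * ((rad a b c : ℝ) * L ^ ω / (Nat.factorial ω : ℝ)) := by ring
    rw [e1, e2]
    exact mul_le_mul_of_nonneg_right h hB0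
  rcases lt_or_ge ω T with hlt | hge
  · -- finitely many `ω < T`: the `ω`-th constant of the family
    have hc := hκf ω a b c ht hab rfl hfew
    have hκ : κf ω ≤ max κT 0 + ∑ t ∈ Finset.range T, max (κf t) 0 := by
      have h1 : max (κf ω) 0 ≤ ∑ t ∈ Finset.range T, max (κf t) 0 :=
        Finset.single_le_sum (f := fun t => max (κf t) 0) (fun i _ => le_max_right _ _)
          (Finset.mem_range.mpr hlt)
      have h2 := le_max_left (κf ω) 0
      have h3 := le_max_right κT 0
      linarith
    exact lt_of_lt_of_le hc (mono _ _ hκ)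
  · -- the tail `T ≤ ω`
    have hc := hT a b c ht hab hge hfew
    have hκ : κT ≤ max κT 0 + ∑ t ∈ Finset.range T, max (κf t) 0 := by
      have := le_max_left κT 0; linarith
    exact lt_of_lt_of_le hc (mono _ _ hκ)


/-! ### Piece 2 from stub 3 and the cited lemma -/

/-- `stub_rstManyPrimes → (rstExponent ≤ A√log) → ManyPrimesSubexp` (piece 2, stated inline; `κ = 1`). [folklore] -/
theorem manyPrimes_of_stubs :
    (∃ C₁ : ℝ, ∀ a b c : ℕ, IsABCTriple a b c → a < b →
      Real.log (rad a b c : ℕ) ≤ ((ArithmeticFunction.cardDistinctFactors (a * b * c) : ℕ) : ℝ) ^ 2 →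
        (c : ℝ) < (rad a b c : ℝ) * Real.exp (rstExponent C₁ (rad a b c : ℕ))) →
    (∀ C₁ : ℝ, ∃ A : ℝ, 0 ≤ A ∧ ∀ k : ℕ, 2 ≤ k → rstExponent C₁ k ≤ A * Real.sqrt (Real.log k)) →
    (∃ κ A : ℝ, ∀ a b c : ℕ, IsABCTriple a b c → a < b →
      Real.log (rad a b c : ℕ) ≤ ((ArithmeticFunction.cardDistinctFactors (a * b * c) : ℕ) : ℝ) ^ 2 →
        (c : ℝ) < κ * (rad a b c : ℝ) * Real.exp (A * Real.sqrt (Real.log (rad a b c : ℕ)))) := by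
  rintro ⟨C₁, h₁⟩ h₂
  obtain ⟨A, hA0, hA⟩ := h₂ C₁
  refine ⟨1, A, fun a b c ht hab hmany => ?_⟩
  have hc := h₁ a b c ht hab hmany
  have hk : 2 ≤ rad a b c := ht.two_le_rad
  have hN0 : (0 : ℝ) ≤ (rad a b c : ℝ) := by positivity
  have hexp : Real.exp (rstExponent C₁ (rad a b c : ℕ)) ≤
      Real.exp (A * Real.sqrt (Real.log (rad a b c : ℕ))) :=
    Real.exp_le_exp.mpr (hA _ hk)
  calc (c : ℝ) < (rad a b c : ℝ) * Real.exp (rstExponent C₁ (rad a b c : ℕ)) := hc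
    _ ≤ (rad a b c : ℝ) * Real.exp (A * Real.sqrt (Real.log (rad a b c : ℕ))) :=
        mul_le_mul_of_nonneg_left hexp hN0
    _ = 1 * (rad a b c : ℝ) * Real.exp (A * Real.sqrt (Real.log (rad a b c : ℕ))) := by ring


/-! ## §3 The composition: the crux BY NAME from the three stubs -/

/-- **THE SKELETON THEOREM.** The crux `Summit.ABC.ABC.Theses.LogCardinality.BakerRefinement`, concluded BY
NAME from the three declared stubs and the cited lemma: pieces 1 and 2 from their stubs (`fewPrimes_of_stubs`,
`manyPrimes_of_stubs`), then the regime glue `bakerRefinement_of_subs`. [folklore] -/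
theorem BakerRefinement_of : BakerRefinement :=
  bakerRefinement_of_subs (fewPrimes_of_stubs stub_fixedOmega stub_tailUniform)
    (manyPrimes_of_stubs stub_rstManyPrimes rstExponent_le_sqrt_log)

/-- The same composition with the stubs (and the lemma statement) as hypotheses (sorry-free).
[folklore] -/
theorem bakerRefinement_of_stubs :
    (∀ t : ℕ, ∃ κ : ℝ, ∀ a b c : ℕ, IsABCTriple a b c → a < b →
      ArithmeticFunction.cardDistinctFactors (a * b * c) = t →
        ((t : ℕ) : ℝ) ^ 2 < Real.log (rad a b c : ℕ) →
          (c : ℝ) < κ * (rad a b c : ℝ) * Real.log (rad a b c : ℕ) ^ t / (Nat.factorial t : ℝ)) →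
    (∃ T : ℕ, ∃ κ : ℝ, ∀ a b c : ℕ, IsABCTriple a b c → a < b →
      T ≤ ArithmeticFunction.cardDistinctFactors (a * b * c) →
        ((ArithmeticFunction.cardDistinctFactors (a * b * c) : ℕ) : ℝ) ^ 2 < Real.log (rad a b c : ℕ) →
          (c : ℝ) < κ * (rad a b c : ℝ) *
            Real.log (rad a b c : ℕ) ^ (ArithmeticFunction.cardDistinctFactors (a * b * c)) /
            (Nat.factorial (ArithmeticFunction.cardDistinctFactors (a * b * c)) : ℝ)) →
    (∃ C₁ : ℝ, ∀ a b c : ℕ, IsABCTriple a b c → a < b →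
      Real.log (rad a b c : ℕ) ≤ ((ArithmeticFunction.cardDistinctFactors (a * b * c) : ℕ) : ℝ) ^ 2 →
        (c : ℝ) < (rad a b c : ℝ) * Real.exp (rstExponent C₁ (rad a b c : ℕ))) →
    (∀ C₁ : ℝ, ∃ A : ℝ, 0 ≤ A ∧ ∀ k : ℕ, 2 ≤ k → rstExponent C₁ k ≤ A * Real.sqrt (Real.log k)) →
    ∃ κ : ℝ, Literature.Barriers.ABC.BakerShapeExplicitABC κ :=
  fun h₁ h₂ h₃ h₄ => bakerRefinement_of_subs (fewPrimes_of_stubs h₁ h₂) (manyPrimes_of_stubs h₃ h₄)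

end Summit.ABC.ABC.Cruxes.BakerRefinement.RegimeSplit
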